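import Literature.MathematicalPhysics.QuantumFieldTheory.Balaban1983to89.Node00.Carriers3Leaf
import Literature.MathematicalPhysics.QuantumFieldTheory.Balaban1983to89.Node00.Satisfiable
import Literature.MathematicalPhysics.QuantumFieldTheory.Balaban1983to89.B6Prop26PrintedStage4KLevelV1

/-!
# NODE N03 · [Balaban1984PropagatorsII] — DISCHARGE DOSSIER at the NODE 00 worlds of record (Stage 3): the node BY NAME modulo EXACTLY the two
# census slots (2.138) ∕ (2.139), its eight printed legs IN KERNEL FORM at the k-level tower block of record, the vacuity guard, non-vacuity, and the
# located readings «what this is ∕ is not» in kernel form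

TRACK A (YM-PLAN §2b, node N03 of 28), seat `pub-ymgap-dag-p1` = n03-a (prover, KNIT-BY-NAME; HUMAN RULING D-0062, chair R429, pattern of `Node00.N04Dossier`
p408815).  THEOREMS ONLY, def-free, sorry-free, standard axioms.  The CONVENTIONS OF RECORD block of the root module `Node00.Carriers` applies.  EVERYTHING
MATHEMATICAL BELOW IS AN EXISTING KERNEL THEOREM OF THE TREE, USED BY NAME (lit-balaban r03 ∕ p21 ∕ p22 ∕ p38 ∕ T8 ∕ b06 lineages; node00-def's Stage-3
chain; dag-p1's discharges and Stage 4); this file is the referee-facing ASSEMBLY for R417 act (iv) — it re-proves nothing of Bałaban's and moves no count.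

## THE NODE.  `Dag.B6_main ℓ := ℓ.b4 → ℓ.b5 → ℓ.b6` (`…Balaban1983to89.Dag` :186) — «N03 · B6 (part II of B5) cites B4 [3] and B5 [4]»; in-edges `b4 ↦ N01`,
`b5 ↦ N02`.  Venue statement `YMDAG.N03 w P := Dag.B6_main (DagBinding.leavesP w P)` (`HOME/lean/ym-dag/N03_B6.lean`).  OWN LEAF at the binding of record:
`b6 ↦ DagBinding.B6BlockParam X.D6` (Lemma 2.1 in PARAMETER form ∧ Props. 2.2, 2.3 ∧ Lemma 2.4 ∧ Props. 2.5, 2.6, 2.7 ∧ Cor. 2.8); at a Stage-3 world of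
record `X.D6 = Node00.D6OfRecord θ` = the k-level tower block `towerBlockOfRecord` (`Node00.CarriersB6K`, node00-def g27) with the tree-gauge and
local-operator carriers of record (`N03_iff_b4_b5_imp_leaf₃`).
VACUITY GUARD (YM-PLAN §1 (i)): at every Stage-3 world of record the in-edge leaves `b4`, `b5` HOLD (N01, N02 by name, §0) AND are NOT CONSUMED — the leaf
`b6` is proved from its own legs (§1); no ex-falso in either direction.

## STATE OF THE DISCHARGE (2026-08-25): MODULO EXACTLY TWO CENSUS SLOTS.  Seven of the eight legs are tree theorems at `D6OfRecord θ` (§2, by name).  The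
eighth, Prop. 2.6, is r03's census `B6.Prop26Printed (kGeoG) (kG)` on the genuine k-level family, itself a tree theorem MODULO its displayed slots:
hm1∕hm2 ((2.137)), hl1–hl5 ((2.140)) and hl3 ((2.140)₄, dag-p1 p407888) are LANDED; dag-p1's Stage 4 `B6Prop26PrintedStage4KLevelV1.prop26Printed_kLevel_of_slots2`
(p409245) leaves **c3 = (2.138)** and **c4 = (2.139)** ONLY — displayed ONCE in §1 as the section hypotheses `hc3`, `hc4` (shapes of
`B6Prop26PrintedStage2KLevelV1.prop26Printed_kLevel_of_slots5` VERBATIM, at `θ`'s parameters).  Their producers are in flight in sibling seats (dag-n03-b: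
`B6Ineq2138KLevelSkeletonV1` p410129 + legs; dag-n02-b: `B6Prop26Census2139KLevelV1` p409034 + `B6Prop26HolderGrad2KLevelV1` p409227 + legs).  When both land,
§1's theorems specialise by `fun θ hθ => …` to the HYPOTHESIS-FREE N03 at every Stage-3 world of record (v1.1 of this file, append-only).

## BOTH-LEGS TABLE (conjunct of `B6BlockParam (D6OfRecord θ)` ↔ typed decl (`B6.lean`∕`DagBinding.lean`) ↔ print (CMP **96** (1984), journal page = PDF page + 222)
## ↔ carrier OF RECORD ↔ the lineage theorem that proves it there, BY NAME — kernel form: `N03_leaf_iff_legs`, `N03_leg_h21` … `N03_leg_h28`)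
| # | typed conjunct | print | carrier of record (`θ : Stage3Params`: dimension `d₆+1 = D`, block `ℓ₆+1 = L`, band `b₀ ≤ b₁`, rate `δ₀ ≤ 2/L`) | proved by (leg) |
|---|---|---|---|---|
| h21 | `DagBinding.B6Lemma21Param` | Lemma 2.1 (2.60)–(2.61) p. 234 under (2.59) | index `KRIdx` (genuine k-level V1 family at `c_f = Lᵏ`), geometry `kGeoU` (`R`-field `R − 1`) | `CarriersB6KDischarge.lemma21Param_tower` — `N03_leg_h21` (`c₁(α) = 2(d+1)·c₁ᵀ(α)`) |
| h22 | `B6.Prop22Printed` | Prop. 2.2 (2.67) p. 234 | `GpU` = T8's `gpTP` at `toKT i`, carrier block `β` | `CarriersB6KDischarge.prop22_tower` ← p21 `prop22Printed_kLevelTorusP` — `N03_leg_h22` |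
| h23 | `B6.Prop23Printed` | Prop. 2.3 (2.86)–(2.87) p. 238 | `CinvU` = T8's `CinvTP` at the carrier blocks | `CarriersB6KLeaves.prop23_tower` — `N03_leg_h23` |
| h24 | `B6.Lemma24Printed` | Lemma 2.4 (2.128) p. 245, PRINTED constant `1/(12d²)` | `treeOfRecord` = b06's `carrier` over all finite `Λ′ ⊂ Lℤ^D` | `Carriers3.lemma24_D6OfRecord` ← `lemma24Printed_carrier` — `N03_leg_h24` (`d₆ ≥ 1`) |
| h25 | `B6.Prop25Printed` | Prop. 2.5 p. 246 | `locOfRecord` = the genuine two-scale `G_□` (`TSIdx.locTS`) | `Carriers3.prop25_D6OfRecord` ← r03 `prop25Printed_TS` — `N03_leg_h25` |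
| h26 | `B6.Prop26Printed` | Prop. 2.6 (2.136)–(2.141) p. 247 | `GU` = r03's census `kG` read at the carrier block | `prop26_tower_of_kGeoG` ∘ Stage 4 — `N03_leg_h26_of_census`, MODULO c3∕c4 |
| h27 | `B6.Prop27Printed` | Prop. 2.7 (2.149) p. 249 | `QinvU` = r03's `kQinv` | `CarriersB6KLeaves.prop27_tower` ← r03 `prop27Printed_kLevel` — `N03_leg_h27` |
| h28 | `B6.Cor28Printed` | Cor. 2.8 (2.150)–(2.151) p. 249 | `HU` = r03's `kH` | `CarriersB6KLeaves.cor28_tower` ← r03 `cor28Printed_kLevel` — `N03_leg_h28` |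

## LOCATED READINGS (ref-A's pre-read checklist 2026-08-25 (d)–(f); cited, not re-litigated; §4 puts them in kernel form)
* (A6 ∕ (d)) `Hyp21_22 := True` on the tower geometry HIDES NOTHING: print's (2.1) «Ω_j a union of big j-blocks» and (2.2) «dist_T(Ω_jᶜ, Ω_{j+1}) > R·M·Lʲ» are
  the FIELDS `bigBlocks`∕`sepT` of the torus family `i.D : TDomains` of every index `i : KIdx` (`N03_printed_21_22_of_index`), and the rest of the printed setting
  (`k ≥ 2`, `M_h = Lᵃ ≥ 8`, `R ≥ 2L²`, `P′ ≥ 5`, `L ≥ 5`, cubes placed, `c_f ≠ 0`, band (2.16)) are fields of `KIdx` (`N03_printed_setting_of_index`); the census's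
  `M₁ ≤ M` is print's «M sufficiently large».
* ((e)) `B6.Prop26Printed` types (2.136)–(2.140) with uniform constants; the sentence «the series (2.141) is convergent in the norms (2.136)–(2.140)» is NOT a clause
  (typed WEAKER than print; `N03_prop26Printed_unfold`); the walk (2.141) is nevertheless HOW every census slot is proved (fixed-point form `G = G₀ + GR`).
* The literal-constant Lemma 2.1 (`c₁(α) = 12c₀(½α)^d`, `B6.StatedBlock`) is refuted for `d ≥ 3` (`B6Lemma21Counterexample.printed_c1_exceeded`, GAPS G-A11-1) —
  the leaf of record is the PARAMETER form (YM-PLAN row N03); (2.60) holds verbatim with the `R`-field `R − 1` (`N03_geometry_dictionary`); `δ₀ ≤ 2/L` is the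
  leaf's Lemma-2.1 rate (`θ.hδ₀`); Lemma 2.4 carries the PRINTED `1/(12d²)` on b06's carriers.
* (GAPS G-B6-2138-SUPP) the census types «supp J ⊂ Δ(y′)» (ONE block) where print has `Δ̃(y′)` (a union of `2^d` blocks): sub-case typed (`N03_suppIn_reading`).
* Sites = index BONDS for Props. 2.7 ∕ Cor. 2.8 (p. 248 «sites replaced by bonds»), blocks for Prop. 2.6; `η = |c_f|⁻¹ = L^{−k}` on the index of record.

## NON-VACUITY (§3).  Stage-3 worlds of record EXIST, also with `D = 4`, `L = 5` (`N03_worldOfRecord₃_exists_dim4_L5`); at `L = 5` the index `KRIdx d 4 …` of the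
tower block is inhabited for every `k ≥ 2` beyond every threshold `M₂ ≤ L·M_h`, `N₁ + 1 ≤ R·L·M_h` (`N03_index_inhabited_L5` ← `kRIdx_nonvacuous_L5` ← r03's
`kLevelFamily_nonvacuous_L5`), so none of the `∀ i, Hyp → M₁ ≤ M → …` legs is vacuous there; the census index likewise (r03's `kLevelG_meets_hypotheses`, by name).  CAVEAT
(located, numbers not adjectives): for `L = 3` (`ℓ₆ = 2`) the index `KIdx` is EMPTY (`4 ≤ ℓ` is a field), so at such worlds Props. 2.2–2.8 hold vacuously; for
odd `L ≥ 7` inhabitation is not in the tree (the top cubes' placement needs p38's deeper chart `ccAt`); the record's non-vacuity witness is `L = 5`.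

## WHAT THIS IS ∕ IS NOT.  IS: the kernel reading of [Balaban1984PropagatorsII] Lemma 2.1 – Cor. 2.8 AS TYPED at the NODE 00 OBJECTS OF RECORD (Stage 3:
`Node00.carriers₃ θ X`, p404803; the block `D6OfRecord θ`), the node BY NAME at every such world and over every record predicate refining Stage 3 (the shape of
dagwriter's `AtRecord Rec Dag.B6_main`, cluster K2 «FlowBounds»), MODULO the two displayed census slots c3∕c4.  IS NOT: a discharge (two slots displayed); a
statement about `L = 3` worlds beyond vacuity, about general odd `L ≥ 7` non-vacuity, about regions other than the V1 torus family, about the construction `w.C`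
(Stage 5), the continuum limit, ℝ⁴, infinite volume, OS axioms, a mass gap or the Clay problem.  One finite four-torus programme at fixed ε.
-/

noncomputable section

namespace Literature.MathematicalPhysics.QuantumFieldTheory.Balaban1983to89.Node00

open DagBinding DagDischargedII
open B4Reflection242 (boxDom blk)
open B4TorusKernel.MultiPeriod (torusSupNorm)
open B6MultiLevelBoxOperator (N0 bigSide)
open B6CubeWindowV1 (Placed GlobalBand)
open B6Cover236MultiLevelBlocks (cubes)
open B6GlobalChartV1 (blkV1)
open B6KLevelCensusIndexV1 (KIdx kGeoG)
open B6Prop26Census2136KLevelV1 (kG)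
open B6Prop26PrintedStage4KLevelV1 (prop26Printed_kLevel_of_slots2)

variable {w : WorldP} {P : B12.RunParams} {X : PrintedCarriersR} {Y : PrintedCarriers9X} {Z : PrintedCarriers11} {V : PrintedCarriers14R}
  {W : PrintedCarriers15}

/-! ## §0. The node is «b4 → b5 → b6»; the vacuity guard (in-edges inhabited at the worlds of record, conclusion proved without them) -/

/-- **N03 reads «b4 → b5 → b6»** (`Iff.rfl`): the implication from the in-edge leaves of N01 ([Balaban1983RegularityDecay] Theorem p. 573) and N02
([Balaban1984PropagatorsI] Props. 1.1–1.2) to its own leaf ([Balaban1984PropagatorsII] Lemma 2.1 – Cor. 2.8).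
[cite: Balaban1984PropagatorsII, Lemma 2.1 – Cor. 2.8 pp.234–249 (the node's content; bookkeeping)] -/
theorem N03_iff_b4_b5_imp_b6 (ℓ : Dag.Leaves) : Dag.B6_main ℓ ↔ (ℓ.b4 → ℓ.b5 → ℓ.b6) := Iff.rfl

/-- The node from its OWN leaf alone — the in-edges are not needed (every proof below concludes this way: no ex-falso route through `b4`∕`b5`).
[cite: Balaban1984PropagatorsII, pp.234–249 (bookkeeping)] -/
theorem N03_of_leaf_b6 (ℓ : Dag.Leaves) (h : ℓ.b6) : Dag.B6_main ℓ := fun _ _ => h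

/-- **VACUITY GUARD, in-edge side**: at every Stage-3 world of record the in-edge leaf `b4` HOLDS (N01 by name, `b4_main_of_isWorldOfRecord₃`).
[cite: Balaban1983RegularityDecay, Theorem p.573 (kernel version of the lit-balaban r01 lineage at the objects of record)] -/
theorem N03_antecedent_b4_at_record₃ (w : WorldP) (hw : IsWorldOfRecord₃ w) (P : B12.RunParams) : (leavesP w P).b4 :=
  b4_main_of_isWorldOfRecord₃ w hw P

/-- **VACUITY GUARD, in-edge side**: at every Stage-3 world of record the in-edge leaf `b5` HOLDS (N02's «b4 → b5» fed with N01's `b4`, both by name).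
[cite: Balaban1984PropagatorsI, Props. 1.1–1.2 pp.33–36 (kernel version at the objects of record)] -/
theorem N03_antecedent_b5_at_record₃ (w : WorldP) (hw : IsWorldOfRecord₃ w) (P : B12.RunParams) : (leavesP w P).b5 :=
  b5_main_of_isWorldOfRecord₃ w hw P (b4_main_of_isWorldOfRecord₃ w hw P)

/-- **At a Stage-3 world of record the node IS «b4 → b5 → `B6BlockParam (D6OfRecord θ)`»**: the leaf `b6` of the N-binding over `carriers₃ θ X` is
the parameter-form block on the k-level tower block of record (`carriers₃_D6`, `rfl`).
[cite: Balaban1984PropagatorsII, pp.223–250 (the stated block at the objects of record; bookkeeping)] -/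
theorem N03_iff_b4_b5_imp_leaf₃ (θ : Stage3Params) (hP : w.up P = Upstream.ofPrintedAllXPN (carriers₃ θ X) Y Z V W) :
    Dag.B6_main (leavesP w P) ↔ ((leavesP w P).b4 → (leavesP w P).b5 → B6BlockParam (D6OfRecord θ)) := by
  have hb6 : (leavesP w P).b6 ↔ B6BlockParam (D6OfRecord θ) := by
    show (w.up P).b6 ↔ _
    rw [hP]
    exact Iff.rfl
  show ((leavesP w P).b4 → (leavesP w P).b5 → (leavesP w P).b6) ↔ _
  rw [hb6]

/-! ## §1. THE TWO OPEN CENSUS SLOTS, displayed once (shapes of `B6Prop26PrintedStage2KLevelV1.prop26Printed_kLevel_of_slots5` VERBATIM, at `θ`) -/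

section Slots

-- the displayed slot c3 = (2.138) at every admissible `θ`
variable (hc3 : ∀ θ : Stage3Params, θ.toStage1Params.Admissible →
    ∃ M₁ δ₃ : ℝ, ∃ Cε : ℝ → ℝ, 0 < M₁ ∧ 0 < δ₃ ∧ ∀ i : KIdx θ.d₆ θ.ℓ₆ θ.hd' θ.hL' θ.b₀ θ.b₁, M₁ ≤ (kGeoG i).M →
      ∀ (ε : ℝ) (J : (kGeoG i).Loc) (y y' : (kGeoG i).Site), 0 < ε → ε < 1 → (kGeoG i).suppIn J y' →
        (kG i).e4 J y ≤ Cε ε * Real.exp (-(δ₃ * (kGeoG i).dist y y')) * ((kGeoG i).holder ε J + (kGeoG i).supNorm J))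
-- the displayed slot c4 = (2.139) at every admissible `θ`
variable (hc4 : ∀ θ : Stage3Params, θ.toStage1Params.Admissible →
    ∃ M₁ δ₃ : ℝ, ∃ Cαε : ℝ → ℝ → ℝ, 0 < M₁ ∧ 0 < δ₃ ∧ ∀ i : KIdx θ.d₆ θ.ℓ₆ θ.hd' θ.hL' θ.b₀ θ.b₁, M₁ ≤ (kGeoG i).M →
      ∀ (α ε : ℝ) (J : (kGeoG i).Loc) (ζ : (kGeoG i).Cut) (y y' : (kGeoG i).Site), 0 ≤ α → 0 < ε → α + ε < 1 →
        (kGeoG i).cutIn ζ y → (kGeoG i).suppIn J y' →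
        (kG i).h2 J α ζ ≤ Cαε α ε * ((kGeoG i).len y) ^ (-α) * (kGeoG i).cutH α ζ * Real.exp (-(δ₃ * (kGeoG i).dist y y')) *
          ((kGeoG i).holder (α + ε) J + (kGeoG i).supNorm J))

include hc3 hc4

/-- **Prop. 2.6 on the genuine k-level census at every admissible `θ`, MODULO c3∕c4** (dag-p1's Stage 4 `prop26Printed_kLevel_of_slots2`; hm2∕hl3∕hl4∕hl5 by name
inside). [cite: Balaban1984PropagatorsII, Prop. 2.6 (2.136)–(2.141) p.247] -/
theorem N03_prop26_census_of_slots (θ : Stage3Params) (hθ : θ.toStage1Params.Admissible) :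
    B6.Prop26Printed (fun i : KIdx θ.d₆ θ.ℓ₆ θ.hd' θ.hL' θ.b₀ θ.b₁ => kGeoG i) (fun i => kG i) :=
  prop26Printed_kLevel_of_slots2 θ.hb.1 θ.hb.2 (hc3 θ hθ) (hc4 θ hθ)

/-- **The leaf at the block of record, MODULO c3∕c4** (`b6BlockParam_D6OfRecord_of_prop26`: h21 ∕ h22 ∕ h23 ∕ h24 ∕ h25 ∕ h27 ∕ h28 discharged by name).
[cite: Balaban1984PropagatorsII, Lemma 2.1 – Cor. 2.8 pp.234–249 (kernel versions of the lineages at the objects of record)] -/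
theorem N03_leaf_at_record₃_of_slots (θ : Stage3Params) (hθ : θ.toStage1Params.Admissible) : B6BlockParam (D6OfRecord θ) :=
  b6BlockParam_D6OfRecord_of_prop26 θ hθ (N03_prop26_census_of_slots hc3 hc4 θ hθ)

/-- **VACUITY GUARD, conclusion side**: at every Stage-3 world of record the node's OWN leaf `b6` holds (modulo c3∕c4) — the in-edges are not consumed.
[cite: Balaban1984PropagatorsII, pp.234–249 (kernel version at the objects of record)] -/
theorem N03_leaf_b6_at_record₃_of_slots (w : WorldP) (hw : IsWorldOfRecord₃ w) (P : B12.RunParams) : (leavesP w P).b6 := by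
  obtain ⟨θ, hθ, hup⟩ := hw
  obtain ⟨X, Y, Z, V, W, hP⟩ := hup P
  show (w.up P).b6
  rw [hP]
  exact N03_leaf_at_record₃_of_slots hc3 hc4 θ hθ

/-- **N03 · [Balaban1984PropagatorsII] AT EVERY NODE 00 WORLD OF RECORD (Stage 3), EVERY RUN, MODULO EXACTLY THE CENSUS SLOTS (2.138) ∕ (2.139)** —
`∀ w, IsWorldOfRecord₃ w → ∀ P, Dag.B6_main (leavesP w P)` (venue: `YMDAG.N03 w P`), node00-def's `b6_main_of_isWorldOfRecord₃_of_prop26` fed with dag-p1's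
Stage 4.  Hypotheses: the world-of-record predicate and the two displayed slots ONLY (no named fact; in-edges not consumed).  When c3∕c4 are tree theorems
this is N03 OF RECORD by `fun θ hθ => …`.
[cite: Balaban1984PropagatorsII, Lemma 2.1 p.234, Props. 2.2–2.3 pp.234–238, Lemma 2.4 p.245, Props. 2.5–2.7 pp.246–249, Cor. 2.8 p.249 — kernel versions of the lineages at the objects of record] -/
theorem N03_at_record₃_of_slots : ∀ w : WorldP, IsWorldOfRecord₃ w → ∀ P : B12.RunParams, Dag.B6_main (leavesP w P) :=
  fun w hw P => b6_main_of_isWorldOfRecord₃_of_prop26 (fun θ hθ => N03_prop26_census_of_slots hc3 hc4 θ hθ) w hw P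

/-- **N03 IN THE STUB SHAPE OF CLUSTER K2 «FlowBounds»** (R422 typing policy: an explicit record-predicate PARAMETER over (family, datum, world) triples,
dagwriter's `AtRecord Rec Dag.B6_main`): for EVERY record predicate whose world component refines Stage 3, modulo c3∕c4.
[cite: Balaban1984PropagatorsII, pp.234–249 — kernel version at the objects of record; bookkeeping over the record-predicate parameter] -/
theorem N03_atRecord_of_refines₃_of_slots {Fam : Type*} {Dat : Fam → Type*} (Rec : ∀ F : Fam, Dat F → WorldP → Prop)
    (hst : ∀ (F : Fam) (D : Dat F) (w : WorldP), Rec F D w → IsWorldOfRecord₃ w) :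
    ∀ (F : Fam) (D : Dat F) (w : WorldP), Rec F D w → ∀ P : B12.RunParams, Dag.B6_main (leavesP w P) :=
  fun F D w hR P => N03_at_record₃_of_slots hc3 hc4 w (hst F D w hR) P

/-- **All four first-cluster nodes N01 ∧ N02 ∧ N03 ∧ N04 at every Stage-3 world of record, modulo c3∕c4.**
[cite: Balaban1983RegularityDecay, Theorem p.573; Balaban1984PropagatorsI, Props. 1.1–1.2 pp.33–36; Balaban1984PropagatorsII, pp.223–250; Balaban1985Averaging, Props. 1–10 pp.26–50 (kernel versions of the lineages)] -/
theorem N01_N02_N03_N04_at_record₃_of_slots (w : WorldP) (hw : IsWorldOfRecord₃ w) (P : B12.RunParams) :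
    Dag.B4_main (leavesP w P) ∧ Dag.B5_main (leavesP w P) ∧ Dag.B6_main (leavesP w P) ∧ Dag.B7_main (leavesP w P) :=
  nodes_N01_N02_N03_N04_of_isWorldOfRecord₃_of_prop26 (fun θ hθ => N03_prop26_census_of_slots hc3 hc4 θ hθ) w hw P

end Slots

/-! ## §2. THE EIGHT LEGS IN KERNEL FORM at the block of record `D6OfRecord θ` (each the lineage's theorem BY NAME) -/

/-- **The leaf IS the eight-fold conjunction** Lemma 2.1 (parameter form) ∧ Prop. 2.2 ∧ Prop. 2.3 ∧ Lemma 2.4 ∧ Prop. 2.5 ∧ Prop. 2.6 ∧ Prop. 2.7 ∧ Cor. 2.8 at the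
block of record (`Iff.rfl`). [cite: Balaban1984PropagatorsII, pp.223–250 (the stated block; bookkeeping)] -/
theorem N03_leaf_iff_legs (θ : Stage3Params) :
    B6BlockParam (D6OfRecord θ) ↔
      B6Lemma21Param (D6OfRecord θ) ∧ B6.Prop22Printed (D6OfRecord θ).geo (D6OfRecord θ).Gp ∧
        B6.Prop23Printed (D6OfRecord θ).d (D6OfRecord θ).geo (D6OfRecord θ).Cinv ∧
        B6.Lemma24Printed (D6OfRecord θ).d (D6OfRecord θ).L (D6OfRecord θ).tree ∧ B6.Prop25Printed (D6OfRecord θ).loc ∧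
        B6.Prop26Printed (D6OfRecord θ).geo (D6OfRecord θ).G ∧ B6.Prop27Printed (D6OfRecord θ).d (D6OfRecord θ).geo (D6OfRecord θ).Qinv ∧
        B6.Cor28Printed (D6OfRecord θ).d (D6OfRecord θ).geo (D6OfRecord θ).H :=
  Iff.rfl

/-- **Leg h21 — Lemma 2.1 in PARAMETER form** on the block of record (dag-p1's `lemma21Param_tower`: (2.60) verbatim with the `R − 1` field, (2.61) with the
fibre factor `2(d+1)`; rate `0 < δ₀ ≤ 2/L`). [cite: Balaban1984PropagatorsII, Lemma 2.1 (2.60)–(2.61) p.234, (2.59) p.233] -/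
theorem N03_leg_h21 (θ : Stage3Params) : B6Lemma21Param (D6OfRecord θ) :=
  lemma21Param_tower θ.one_le_ℓ₆ θ.hδ₀.1 θ.hδ₀.2 _ _

/-- **Leg h22 — Proposition 2.2 (2.67), both conjuncts** (dag-p1's `prop22_tower` from p21's torus census). [cite: Balaban1984PropagatorsII, Prop. 2.2 (2.67) p.234] -/
theorem N03_leg_h22 (θ : Stage3Params) : B6.Prop22Printed (D6OfRecord θ).geo (D6OfRecord θ).Gp :=
  prop22_tower θ.one_le_ℓ₆

/-- **Leg h23 — Proposition 2.3 (2.86)–(2.87)** (node00-def's `prop23_tower` from T8's torus census). [cite: Balaban1984PropagatorsII, Prop. 2.3 (2.86)–(2.87) p.238] -/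
theorem N03_leg_h23 (θ : Stage3Params) : B6.Prop23Printed (D6OfRecord θ).d (D6OfRecord θ).geo (D6OfRecord θ).Cinv :=
  prop23_tower θ.d₆ θ.ℓ₆ θ.hd' θ.hL' θ.b₀ θ.b₁ θ.one_le_ℓ₆

/-- **Leg h24 — Lemma 2.4 (2.128) with the PRINTED constant** at the tree-gauge carriers of record (`lemma24_D6OfRecord`, b06's lineage; `d₆ ≥ 1`).
[cite: Balaban1984PropagatorsII, Lemma 2.4 (2.128) p.245] -/
theorem N03_leg_h24 (θ : Stage3Params) (hθ : θ.toStage1Params.Admissible) :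
    B6.Lemma24Printed (D6OfRecord θ).d (D6OfRecord θ).L (D6OfRecord θ).tree :=
  lemma24_D6OfRecord θ (θ.one_le_d₆ hθ)

/-- **Leg h25 — Proposition 2.5** at the genuine two-scale local operators of record (`prop25_D6OfRecord`, r03's census `prop25Printed_TS`).
[cite: Balaban1984PropagatorsII, Prop. 2.5 p.246] -/
theorem N03_leg_h25 (θ : Stage3Params) : B6.Prop25Printed (D6OfRecord θ).loc :=
  prop25_D6OfRecord θ

/-- **Leg h27 — Proposition 2.7 (2.149)** (node00-def's `prop27_tower`, r03's k-level census). [cite: Balaban1984PropagatorsII, Prop. 2.7 (2.149) p.249] -/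
theorem N03_leg_h27 (θ : Stage3Params) : B6.Prop27Printed (D6OfRecord θ).d (D6OfRecord θ).geo (D6OfRecord θ).Qinv :=
  prop27_tower θ.d₆ θ.ℓ₆ θ.hd' θ.hL' θ.hb.1 θ.hb.2

/-- **Leg h28 — Corollary 2.8 (2.150)–(2.151)** (node00-def's `cor28_tower`, r03's k-level census). [cite: Balaban1984PropagatorsII, Cor. 2.8 (2.150)–(2.151) p.249] -/
theorem N03_leg_h28 (θ : Stage3Params) : B6.Cor28Printed (D6OfRecord θ).d (D6OfRecord θ).geo (D6OfRecord θ).H :=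
  cor28_tower θ.d₆ θ.ℓ₆ θ.hd' θ.hL' θ.hb.1 θ.hb.2

/-- **Leg h26 IS the open one — and the ONLY one**: at the block of record the leaf is EQUIVALENT to its Prop. 2.6 conjunct (dag-p1's `b6BlockParam_tower_iff`).
[cite: Balaban1984PropagatorsII, Prop. 2.6 (2.136)–(2.141) p.247, pp.223–250] -/
theorem N03_leaf_iff_prop26 (θ : Stage3Params) (hθ : θ.toStage1Params.Admissible) :
    B6BlockParam (D6OfRecord θ) ↔ B6.Prop26Printed (D6OfRecord θ).geo (D6OfRecord θ).G :=
  b6BlockParam_tower_iff (θ.one_le_d₆ hθ) θ.one_le_ℓ₆ θ.hb.1 θ.hb.2 θ.hδ₀.1 θ.hδ₀.2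

/-- **Leg h26 from r03's census form** (`prop26_tower_of_kGeoG`: blocks → bonds through the carrier block): the census `B6.Prop26Printed (kGeoG) (kG)` — itself
Stage 4 modulo c3∕c4 — gives the conjunct at the block of record. [cite: Balaban1984PropagatorsII, Prop. 2.6 (2.136)–(2.141) p.247, p.248 («sites replaced by bonds»)] -/
theorem N03_leg_h26_of_census (θ : Stage3Params)
    (h26 : B6.Prop26Printed (fun i : KIdx θ.d₆ θ.ℓ₆ θ.hd' θ.hL' θ.b₀ θ.b₁ => kGeoG i) (fun i => kG i)) :
    B6.Prop26Printed (D6OfRecord θ).geo (D6OfRecord θ).G :=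
  prop26_tower_of_kGeoG h26

/-! ## §3. NON-VACUITY, BY NAME: Stage-3 worlds of record exist — also with `D = 4`, `L = 5` — and at `L = 5` the index of the tower block is inhabited beyond
every census threshold, so neither the world class nor the census `∀ i, … → M₁ ≤ M → …` is empty -/

/-- **Stage-3 worlds of record EXIST with `D = 4`, `L = 5`**: the admissible Stage-1 family of `Stage1Params.exists_admissible` with its block size set to `5`
(admissibility does not constrain `L`), coefficient algebra `ℂ`, `d₆ = 3`, `ℓ₆ = 4`, band `b₀ = b₁ = 1`, rate `δ₀ = 2/5`; the un-pinned bundles degenerate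
(`Node00.Satisfiable`).  So `N03_at_record₃_of_slots` does not quantify over an empty class, and at THESE worlds the census index is inhabited (next theorem).
[cite: Balaban1984PropagatorsII, (2.1)–(2.4) p.224, (2.16) p.225 (Stage-3 parameter dictionary) — bookkeeping] -/
theorem N03_worldOfRecord₃_exists_dim4_L5 :
    ∃ (θ : Stage3Params) (w : WorldP), θ.toStage1Params.Admissible ∧ θ.D = 4 ∧ θ.L = 5 ∧ θ.ℓ₆ = 4 ∧ IsWorldOfRecord₃ w ∧
      ∀ P : B12.RunParams, ∃ (X : PrintedCarriersR) (Y : PrintedCarriers9X) (Z : PrintedCarriers11) (V : PrintedCarriers14R) (W : PrintedCarriers15),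
        w.up P = Upstream.ofPrintedAllXPN (carriers₃ θ X) Y Z V W := by
  obtain ⟨θ, hθ, hD⟩ := Stage1Params.exists_admissible
  obtain ⟨X⟩ := nonempty_printedCarriersR
  obtain ⟨Y⟩ := nonempty_printedCarriers9X
  obtain ⟨Z⟩ := nonempty_printedCarriers11
  obtain ⟨V⟩ := nonempty_printedCarriers14R
  obtain ⟨W⟩ := nonempty_printedCarriers15
  obtain ⟨w⟩ := nonempty_worldP
  let θ₃ : Stage3Params :=
    { θ with
      L := 5, hL := ⟨⟨2, by norm_num⟩, by norm_num⟩
      𝔸 := ℂ, d₆ := 3, ℓ₆ := 4, hd₆ := by omega, hℓ₆ := rfl, b₀ := 1, b₁ := 1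
      hb := ⟨one_pos, le_rfl⟩, δ₀ := 2 / (((4 : ℕ) : ℝ) + 1), hδ₀ := ⟨by positivity, le_rfl⟩ }
  have hθ₃ : θ₃.toStage1Params.Admissible := hθ
  refine ⟨θ₃, WorldP.withUp w fun _ => Upstream.ofPrintedAllXPN (carriers₃ θ₃ X) Y Z V W, hθ₃, hD, rfl, rfl,
    isWorldOfRecord₃_of_up θ₃ hθ₃ X Y Z V W _ rfl, fun P => ⟨X, Y, Z, V, W, rfl⟩⟩

/-- **At `L = 5` (`ℓ₆ = 4`) THE INDEX OF THE TOWER BLOCK OF RECORD IS INHABITED BEYOND EVERY THRESHOLD** — for every `k ≥ 2`, every real `M₂` and natural `N₁`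
a member with `k` levels, `M₂ ≤ M = L·M_h`, `N₁ + 1 ≤ R·L·M_h` (dag-p1's `kRIdx_nonvacuous_L5` on r03's witness `kLevelFamily_nonvacuous_L5`): the `∀ i, Hyp → M₁ ≤ M → …`
of Lemma 2.1 ∕ Props. 2.2, 2.3, 2.6, 2.7 ∕ Cor. 2.8 at `D6OfRecord θ` are NOT vacuous at such `θ`. [cite: Balaban1984PropagatorsII, (2.1)–(2.4) p.224, (2.16) p.225, Prop. 2.2 p.234 («M is sufficiently large»)] -/
theorem N03_index_inhabited_L5 (d k : ℕ) (hd : 1 ≤ d + 1) (hL : Odd (4 + 1) ∧ 1 < 4 + 1) (hk : 2 ≤ k) (M₂ : ℝ) (N₁ : ℕ)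
    {b₀ b₁ : ℝ} (hb₀ : 0 < b₀) (hb₁ : b₀ ≤ b₁) :
    ∃ i : KRIdx d 4 hd hL b₀ b₁, i.1.k = k ∧ (kGeoU i.1).Hyp21_22 ∧ M₂ ≤ (kGeoU i.1).M ∧ N₁ + 1 ≤ i.1.R * ((4 + 1) * i.1.Mh) := by
  obtain ⟨i, hk', hM, hN⟩ := kRIdx_nonvacuous_L5 d k hd hL hk M₂ N₁ hb₀ hb₁
  exact ⟨i, hk', trivial, hM, hN⟩

/-- the index and geometry of the block of record ARE `KRIdx` ∕ `kGeoU` at `θ`'s parameters (`rfl`), so `N03_index_inhabited_L5` applies to every `θ` with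
`ℓ₆ = 4`. [cite: Balaban1984PropagatorsII, (2.1)–(2.4) p.224 (dictionary)] -/
theorem N03_block_index (θ : Stage3Params) :
    (D6OfRecord θ).I = KRIdx θ.d₆ θ.ℓ₆ θ.hd' θ.hL' θ.b₀ θ.b₁ ∧ ∀ i : (D6OfRecord θ).I, (D6OfRecord θ).geo i = kGeoU i.1 :=
  ⟨rfl, fun _ => rfl⟩

-- The census antecedent `M₁ ≤ (kGeoG i).M` is met beyond every threshold at `L = 5`: r03's
-- `B6Prop26Census2136KLevelV1.kLevelG_meets_hypotheses` BY NAME (not restated here).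

/-! ## §4. LOCATED READINGS IN KERNEL FORM (referee checklist ref-A 2026-08-25 (d)–(f)) -/

/-- **(A6) `Hyp21_22 := True` HIDES NOTHING**: the geometry field `Hyp21_22` of every member of the block of record is `True` BY DEFINITION (`Iff.rfl`) — because
print's (2.1)–(2.2) are not hypotheses ON a member but FIELDS OF its index: see `N03_printed_21_22_of_index`. [cite: Balaban1984PropagatorsII, (2.1)–(2.2) p.224 (located reading)] -/
theorem N03_hyp21_22_iff_true (θ : Stage3Params) (i : (D6OfRecord θ).I) : ((D6OfRecord θ).geo i).Hyp21_22 ↔ True := Iff.rfl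

/-- **PRINT'S (2.1) AND (2.2) ARE CARRIED BY EVERY INDEX** `i : KIdx` as the fields `bigBlocks` («Ω_j is a union of big j-blocks», (2.1)) and `sepT`
(«dist_T(Ω_jᶜ, Ω_{j+1}) > R·M·Lʲ», (2.2) with the torus distance) of its torus family `i.D : TDomains` (`B6MultiLevelTorusOperator.TDomains`).
[cite: Balaban1984PropagatorsII, (2.1)–(2.2) p.224] -/
theorem N03_printed_21_22_of_index {d ℓ : ℕ} {hd : 1 ≤ d + 1} {hL : Odd (ℓ + 1) ∧ 1 < ℓ + 1} {b₀ b₁ : ℝ} (i : KIdx d ℓ hd hL b₀ b₁) :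
    (∀ j, 2 ≤ j → ∀ x ∈ boxDom (N0 ℓ i.Mh i.k i.P'), ∀ x' ∈ boxDom (N0 ℓ i.Mh i.k i.P'),
        blk (bigSide ℓ i.Mh j) x' = blk (bigSide ℓ i.Mh j) x → (j ≤ i.D.lev x ↔ j ≤ i.D.lev x')) ∧
    (∀ j, ∀ x ∈ boxDom (N0 ℓ i.Mh i.k i.P'), ∀ x' ∈ boxDom (N0 ℓ i.Mh i.k i.P'), i.D.lev x < j → j + 1 ≤ i.D.lev x' →
        ((i.R * bigSide ℓ i.Mh j : ℕ) : ℝ) < torusSupNorm (N0 ℓ i.Mh i.k i.P') (x - x')) :=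
  ⟨i.D.bigBlocks, i.D.sepT⟩

/-- **THE REMAINING PRINTED SETTING IS CARRIED BY THE INDEX TOO**: `k ≥ 2` levels, `M_h = Lᵃ ≥ 8`, `R ≥ 2L²`, `P′_μ ≥ 5`, `L ≥ 5`, every cube placed, `c_f ≠ 0`,
positive weights in the band (2.16) — the fields of `KIdx` (r03's `B6KLevelCensusIndexV1`); the «M sufficiently large» thresholds are the census's `M₁ ≤ M`.
[cite: Balaban1984PropagatorsII, (2.1)–(2.4) p.224, (2.16) p.225, (2.20) p.226] -/
theorem N03_printed_setting_of_index {d ℓ : ℕ} {hd : 1 ≤ d + 1} {hL : Odd (ℓ + 1) ∧ 1 < ℓ + 1} {b₀ b₁ : ℝ} (i : KIdx d ℓ hd hL b₀ b₁) :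
    2 ≤ i.k ∧ i.Mh = (ℓ + 1) ^ i.a ∧ 8 ≤ i.Mh ∧ 2 * (ℓ + 1) ^ 2 ≤ i.R ∧ (∀ μ, 5 ≤ i.P' μ) ∧ 4 ≤ ℓ ∧
      (∀ c : ↥(cubes i.D.toDomains), Placed ℓ i.k i.P' c.1) ∧ i.cf ≠ 0 ∧ (∀ b, 0 < i.w b) ∧ GlobalBand b₀ b₁ i.cf i.w :=
  ⟨i.hk2, i.hMha, i.hM8, i.hR2, i.hP5, i.hℓ, i.hpl, i.hcf, i.hw, i.hwb⟩

/-- **(e) WHAT `B6.Prop26Printed` TYPES, UNFOLDED** (`Iff.rfl`): the inequalities (2.136)–(2.140) with constants `(C, C(α), C(ε), C(α,ε), δ₃)` uniform over the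
family above ONE threshold `M₁ ≤ M` — the sentence «the series (2.141) is convergent in the norms (2.136)–(2.140)» is NOT a clause (typed WEAKER than print;
located, cf. lit-balaban ROWS-B6 row B6.Prop2.6). [cite: Balaban1984PropagatorsII, Prop. 2.6 (2.136)–(2.141) p.247 (located reading)] -/
theorem N03_prop26Printed_unfold {I : Type} (geo : I → B6.Geometry) (G : ∀ i, B6.GFamily (geo i)) :
    B6.Prop26Printed geo G ↔
      ∃ M₁ δ₃ C : ℝ, ∃ Cα Cε : ℝ → ℝ, ∃ Cαε : ℝ → ℝ → ℝ, 0 < M₁ ∧ 0 < δ₃ ∧ 0 < C ∧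
        ∀ i : I, (geo i).Hyp21_22 → M₁ ≤ (geo i).M → B6.Ineq2136_2140 (G i) C Cα Cε Cαε δ₃ :=
  Iff.rfl

/-- **THE GEOMETRY DICTIONARY OF THE BLOCK OF RECORD, BY `rfl`**: sites = index BONDS (p. 248 «sites replaced by bonds»), `η = |c_f|⁻¹` with `c_f = Lᵏ` (print's
units (2.1)), `M = L·M_h`, and the `R`-field `R − 1` (the reading under which (2.60) holds verbatim on the torus families, dag-p1's `B6Lemma21ParamKLevelTorus`).
[cite: Balaban1984PropagatorsII, (2.1)–(2.2) p.224, p.248, Lemma 2.1 (2.60) p.234 (located readings)] -/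
theorem N03_geometry_dictionary (θ : Stage3Params) (i : (D6OfRecord θ).I) :
    ((D6OfRecord θ).geo i).R = (i.1.R : ℝ) - 1 ∧ ((D6OfRecord θ).geo i).eta = |i.1.cf|⁻¹ ∧
      i.1.cf = (((θ.ℓ₆ + 1 : ℕ) : ℝ)) ^ i.1.k ∧ ((D6OfRecord θ).geo i).M = (((θ.ℓ₆ + 1 : ℕ) : ℝ)) * (i.1.Mh : ℝ) :=
  ⟨rfl, rfl, i.2, rfl⟩

/-- **(GAPS G-B6-2138-SUPP) THE CENSUS SUPPORT CONDITION IS ONE BLOCK**: «supp J ⊂ Δ(y′)» reads `∀ x, J x ≠ 0 → y(x) = y′` (print's Δ̃(y′) is a union of `2^d`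
blocks — the census types the sub-case; `Iff.rfl`). [cite: Balaban1984PropagatorsII, Prop. 2.6 p.247 («supp J ⊂ Δ̃(y′)»), p.232 («Δ(y) = B^j(y)») (located reading)] -/
theorem N03_suppIn_reading {d ℓ : ℕ} {hd : 1 ≤ d + 1} {hL : Odd (ℓ + 1) ∧ 1 < ℓ + 1} {b₀ b₁ : ℝ} (i : KIdx d ℓ hd hL b₀ b₁) (J : (kGeoG i).Loc)
    (y' : (kGeoG i).Site) : (kGeoG i).suppIn J y' ↔ ∀ x, J x ≠ 0 → blkV1 i.hN i.D x = y' := Iff.rfl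

end Literature.MathematicalPhysics.QuantumFieldTheory.Balaban1983to89.Node00

end
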